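import Summits.CriticalPhenomena.PercolationContinuityZ3.Theorems.SoloBlindKNUniformCoefficients

/-!
# Screened targets are removable (Kozma–Nitzan Conjecture 4 / Question 5 / Conjecture 2)

A target `a ∈ A` is SCREENED (from `o`, by the other targets) if `{o ↔ a} ⊆ {o ↔ A ∖ {a}}` as events —
e.g. when every path from `o` to `a` passes through another target.  Then `{o ↔ A} = {o ↔ A ∖ {a}}`, so each of
Conjecture 4, Question 5 and Conjecture 2 of [KozmaNitzan2024] at `(G, A ∖ {a}, o)` implies the same statement at
`(G, A, o)` (`knConj4Real_of_erase`, `knQuestion5_of_erase`, `knConj2All_of_erase`; screening is the hypothesis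
`openConn o a ⊆ connTo o (A.erase a)`): the minimum over fewer targets is
larger, and coefficients extend by zero.  Iterating (`knQuestion5_of_unscreened_cores`): Question 5 for every
non-empty `A` follows from Question 5 on the UNSCREENED CORES `B ⊆ A` (every target of `B` unscreened within `B`).

Motivation (numerical, this programme): the negative coefficients of Kozma–Nitzan's Theorem-11 system for `|A| ≥ 4`
were only ever observed at screened targets, so the reduction isolates the regime in which their explicit candidate
coefficients are available.  Elementary; finite graphs, arbitrary edge weights; no sorry, no new axioms.
[cite: KozmaNitzan2024, Conjecture 4 (p. 32), Question 5 (pp. 32–33), Theorem 11 (p. 33)]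
-/

noncomputable section

open MeasureTheory Set Finset
open scoped BigOperators
open Literature.Probability.LatticeModels (prodBernoulli)
open Literature.Probability.Percolation

namespace Summit.CriticalPhenomena.PercolationContinuityZ3.Theorems.SoloBlindKN

section Percolation

variable {V : Type*} [Fintype V] [DecidableEq V]

omit [Fintype V] in
/-- A target `a` is SCREENED (from `o`, by the other targets) when `{o ↔ a} ⊆ {o ↔ A ∖ {a}}` as events.
Removing a screened target does not change `{o ↔ A}`. -/
theorem connTo_eq_of_screened {o : V} {A : Finset V} {a : V} (h : openConn o a ⊆ connTo o (A.erase a)) :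
    connTo o A = connTo o (A.erase a) := by
  apply Set.Subset.antisymm
  · intro ω hω
    simp only [connTo, mem_iUnion, exists_prop] at hω
    obtain ⟨a', ha', hω⟩ := hω
    by_cases haa : a' = a
    · subst haa; exact h hω
    · exact mem_iUnion₂.2 ⟨a', Finset.mem_erase.2 ⟨haa, ha'⟩, hω⟩
  · intro ω hω
    simp only [connTo, mem_iUnion, exists_prop] at hω ⊢
    obtain ⟨a', ha', hω⟩ := hω
    exact ⟨a', Finset.mem_of_mem_erase ha', hω⟩

/-- `E_F(x)` is unchanged by removing a screened target. -/
theorem clusterExp_eq_of_screened (w : Sym2 V → unitInterval) {o : V} {A : Finset V} {a : V}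
    (h : openConn o a ⊆ connTo o (A.erase a)) (F : Set V → ℝ) (x : V) :
    clusterExp w A o F x = clusterExp w (A.erase a) o F x := by
  simp only [clusterExp, clusterPM, connTo_eq_of_screened h]

/-- **Conjecture 4: screened targets are removable.** -/
theorem knConj4Real_of_erase (w : Sym2 V → unitInterval) {o : V} {A : Finset V} {a : V}
    (h : openConn o a ⊆ connTo o (A.erase a)) (h4 : KNConj4Real w (A.erase a) o) : KNConj4Real w A o := by
  intro F hF
  obtain ⟨a', ha', hle⟩ := h4 F hF
  refine ⟨a', Finset.mem_of_mem_erase ha', ?_⟩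
  rwa [clusterExp_eq_of_screened w h F a', clusterExp_eq_of_screened w h F o]

omit [Fintype V] in
/-- Extending coefficients on `A.erase a` by zero at `a`: the sum over `A` is the sum over `A.erase a`. -/
theorem sum_extend_zero {A : Finset V} {a : V} (ha : a ∈ A) (g : V → ℝ) :
    ∑ x ∈ A, (if x = a then 0 else g x) = ∑ x ∈ A.erase a, g x := by
  rw [← Finset.add_sum_erase A _ ha, if_pos rfl, zero_add]
  exact Finset.sum_congr rfl fun x hx => by rw [if_neg (Finset.ne_of_mem_erase hx)]

omit [Fintype V] in
/-- **Question 5: screened targets are removable** (coefficients extended by `0` at `a`). -/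
theorem knQuestion5_of_erase (w : Sym2 V → unitInterval) {o : V} {A : Finset V} {a : V} (ha : a ∈ A)
    (h : openConn o a ⊆ connTo o (A.erase a)) (h5 : KNQuestion5 w (A.erase a) o) : KNQuestion5 w A o := by
  obtain ⟨c, hc0, hc1, hb⟩ := h5
  refine ⟨fun x => if x = a then 0 else c x, fun x => ?_, ?_, fun b => ?_⟩
  · by_cases hx : x = a
    · simp [hx]
    · simp [hx, hc0 x]
  · rw [sum_extend_zero ha]; exact hc1
  · have e : ∀ x, (if x = a then (0 : ℝ) else c x) * (prodBernoulli w).real (openConn x b ∩ connTo o A) =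
        if x = a then 0 else c x * (prodBernoulli w).real (openConn x b ∩ connTo o (A.erase a)) := by
      intro x
      by_cases hx : x = a
      · simp [hx]
      · simp [hx, connTo_eq_of_screened h]
    simp_rw [e]
    rw [sum_extend_zero ha]
    exact hb b

omit [Fintype V] in
/-- **Conjecture 2: screened targets are removable.** -/
theorem knConj2All_of_erase (w : Sym2 V → unitInterval) {o : V} {A : Finset V} {a : V}
    (h : openConn o a ⊆ connTo o (A.erase a)) (h2 : KNConj2All w (A.erase a) o) : KNConj2All w A o := by
  intro b
  obtain ⟨a', ha', hle⟩ := h2 b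
  refine ⟨a', Finset.mem_of_mem_erase ha', ?_⟩
  rwa [connTo_eq_of_screened h]

omit [Fintype V] in
/-- A singleton screened target is never reached: `{o ↔ a} = ∅`, and Question 5 holds trivially. -/
theorem knQuestion5_singleton_of_screened (w : Sym2 V → unitInterval) {o a : V}
    (h : openConn o a ⊆ connTo o (({a} : Finset V).erase a)) : KNQuestion5 w {a} o := by
  have he : openConn o a = (∅ : Set (BondConfig V)) := by
    apply Set.Subset.antisymm _ (Set.empty_subset _)
    intro ω hω
    have := h hω
    simp [connTo, Finset.erase_singleton] at this
  refine ⟨fun x => if x = a then 1 else 0, fun x => ?_, by simp, fun b => ?_⟩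
  · by_cases hx : x = a <;> simp [hx]
  · have hA : connTo o ({a} : Finset V) = ∅ := by simp [connTo, he]
    simp only [Finset.sum_singleton, hA, Set.inter_empty, measureReal_empty, mul_zero]
    exact measureReal_nonneg

omit [Fintype V] in
/-- **Reduction to unscreened cores.**  If Question 5 holds at `(G, B, o)` for every non-empty `B ⊆ A` in which
no target is screened (within `B`), then it holds at `(G, A, o)` for `A` non-empty. (New; elementary.) -/
theorem knQuestion5_of_unscreened_cores (w : Sym2 V → unitInterval) (o : V) (A : Finset V) (hA : A.Nonempty)
    (hcore : ∀ B ⊆ A, B.Nonempty → (∀ a ∈ B, ¬ (openConn o a ⊆ connTo o (B.erase a))) → KNQuestion5 w B o) :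
    KNQuestion5 w A o := by
  -- strong induction on the number of targets, over all `B ⊆ A`
  suffices H : ∀ n : ℕ, ∀ B : Finset V, B.card ≤ n → B ⊆ A → B.Nonempty → KNQuestion5 w B o from
    H A.card A le_rfl Finset.Subset.rfl hA
  intro n
  induction n with
  | zero =>
    intro B hB _ hBn
    exact absurd (Finset.card_pos.2 hBn) (by omega)
  | succ n ih =>
    intro B hB hBA hBn
    by_cases hs : ∃ a ∈ B, openConn o a ⊆ connTo o (B.erase a)
    · obtain ⟨a, ha, hsa⟩ := hs
      by_cases hne : (B.erase a).Nonempty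
      · have hcard : (B.erase a).card ≤ n := by
          have := Finset.card_erase_of_mem ha
          omega
        exact knQuestion5_of_erase w ha hsa (ih (B.erase a) hcard ((Finset.erase_subset a B).trans hBA) hne)
      · have hBe : B = {a} := by
          rw [Finset.not_nonempty_iff_eq_empty] at hne
          ext x
          simp only [Finset.mem_singleton]
          constructor
          · intro hx
            by_contra hxa
            have hx' : x ∈ B.erase a := Finset.mem_erase.2 ⟨hxa, hx⟩
            rw [hne] at hx'
            simp at hx'
          · rintro rfl; exact ha
        subst hBe
        exact knQuestion5_singleton_of_screened w hsa
    · push Not at hs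
      exact hcore B hBA hBn hs

end Percolation

end Summit.CriticalPhenomena.PercolationContinuityZ3.Theorems.SoloBlindKN

end
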